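import Literature.MathematicalPhysics.QuantumFieldTheory.Balaban1983to89.B12PlaquetteLoop267
import Literature.MathematicalPhysics.QuantumFieldTheory.Balaban1983to89.B7Prop2Explicit
import Summits.QuantumFields.BalabanUV.T4Continuum.Support.ShellMeasureAverageAnalyticB7

/-!
# `T4Continuum.ShellMeasureAverageIterateRegular` — [B7] PROPOSITIONS 1–2 TRANSPORTED TO THE b12-TYPED AVERAGE (15):
# the printed one-step block average `B12AverageCorridor267.avgM L gammaT` IS b07's concrete average (42)
# `B7Prop1Explicit.bavg`, so the `k`-fold averaged backgrounds `Ū₀ʲ`, `j ≤ k`, are UNITARY, PLAQUETTE-REGULAR and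
# LOOP-REGULAR at every level from print's (52) ALONE — the per-level regime binders of rows S49∕S57, DISCHARGED
(cell `pub-balaban`, sub-cell `t4`, spine estimate NE7c (node U5b); NE7c ROUND-2 crew `t4-ne7c-formalise-*`, unit
`b2b-balaban-t4-ne7c-formalise-leaf-04` gen 4; owner table `LEAVES-NE7c-P1.md` v2.5 row **S59** (BOOKED by the owner
t4-ne7c-p1-g28, journal l.14087, on this seat's OFFER l.14030); companion of row S57 (holder leaf-06-g3,
`ShellMeasureAverageIterate` p219561) and of the owner's row S49 (`ShellMeasureAverageAnalyticB7` p219014, f5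
`ShellMeasureAverageAnalyticRegular` p219628); ADDITIVE — imports `B12PlaquetteLoop267` (b12 lineage), `B7Prop2Explicit` (b07
lineage) and the owner's S49 f2 BY NAME, modifies nothing; 0 `def`, 0 `def … : Prop`, 0 sorry)

HONEST FRAMING.  Finite four-torus programme, rung (B)+1 only — NOT infinite volume, NOT a mass gap, NOT the Clay
problem, NOT summit progress; (B), `BetaPertHyp`, (B^μ) are not consumed.  NE7c (`T4IndicatorShell.ShellWeightBound`) is
NOT PRINTED and NOT PROVED; «NE7c ⇐ the named binders».  THIS FILE IS A JUNCTION between two TREE typings of ONE printed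
formula — [Balaban1985Averaging] (15) p. 19 = (42) p. 23 «`Ū_c = exp[i Σ_{x∈B(c₋)} L^{−d} (1∕i) log U(Γ_{c,x}) U(c)⁻¹] U(c)`»
— namely the b12 lineage's `B12AverageCorridor267.avgM L (gammaT L ·) U c` (single transporter family, the contours (1.7) of
[Balaban1984PropagatorsI], corner cubes on `ℤᵈ`, cell DIVERGENCE D-b12g20.1) and the b07 lineage's `B7Prop1Explicit.bavg L V q κ`
(word holonomies, the same contours, the same corner cubes), plus the CONSUMPTION BY NAME of b07's kernel-checked
Proposition 2 (`B7Prop2Explicit.prop2_explicit` ∕ `avgIter_mem` ∕ `ineq53_explicit` ∕ `norm_Wcx_sub_one_le`: (52)–(54) p. 26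
for the `k`-fold average (43) with explicit `C₀(d)`, `c₂′(d,L)`).  Nothing of the manuscript is asserted here; every
`[cite: …]` tag marks the TEXT LOCATION of the object typed, not an imported fact.  HONEST DEPENDENCY (cell): continuum YM
on T⁴ ⇐ BetaPertH ∧ nine spine estimates (0/9 proved); BetaPertH ⇐ (D1) ∧ (D4) ∧ CAP+tail; G-an2-4 gates asym, D1 and
NE2/3/4.

WHY.  Row S57 (`ShellMeasureAverageIterate`, [B7] Prop. 6 (164) SHAPE for the (15) average) and the owner's W-d analytic
half (S49 f2) carry, at every level `j` of the averaging pyramid, the REGIME BINDERS «`‖V_j(b)‖ ≤ 1`, `‖V_j(b)⁻¹‖ ≤ 1`»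
and «off-axis block loops `‖W_x(V_j) − 1‖ ≤ ε ≤ 1∕8`» (S57 f1 header, honest difference (ii): «the REGULARITY OF THE
AVERAGED BACKGROUNDS at every level … is a DISPLAYED hypothesis (print: Props 1–2 (52) ⇒ regular at all levels)»).  For the
AVERAGED backgrounds `V_j = Ū₀ʲ` of [B7] (127)∕(159) these binders ARE print's Proposition 2, which the tree holds in b07's
typing; the b12 lineage already PROVED the dictionary for the transporters and the block loop
(`B12PlaquetteLoop267.gammaT_eq_hol_treeWord`, `loopW_gammaT_eq_Wcx`, `hol_seg_eq_lineR`, `hol_curry_plaqWord`).  This file adds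
the one missing line of the dictionary — THE AVERAGE ITSELF — and reads Prop. 2 through it.

WHAT IS PROVED (kernel, no `sorry`; [folklore] = bookkeeping, [cite] = transcription locus).
* §1 DICTIONARY.  `sum_blockSites_eq_sum_boxVec` (a sum over the corner block `B(y)` of the b12 lineage = a sum over
  b07's offsets `r : Fin d → Fin L`), `expU_eq_expUnit`, `Ustr_eq_hol_seg`, **`avgM_gammaT_eq_bavg`**:
  `avgM L (gammaT L ·) U c = bavg L (Function.curry U) (blockBase L c.1) c.2`; hence **`avgM_gammaT_eq_rescale_bavg`** (the
  one-step averaged configuration on the coarse lattice `ℤᵈ` IS b07's `rescale L (bavg L (curry U))` = `avgIter L (curry U) 1`),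
  **`uncurry_avgIter_succ`** (the level-`j` averaged background `Ubar j := uncurry (B7Prop2Explicit.avgIter L (curry U) j)`
  obeys the b12 recursion `Ubar (j+1) c = avgM L gammaT (Ubar j) c`), `iterate_eq_uncurry_avgIter` (so ANY b12-side iterate
  defined by that recursion is it), `plaquetteHolonomyZd_uncurry` (b12 plaquette holonomy of `uncurry W` = b07's
  `hol W x (plaqWord i j)`).
* §2 [B7] PROP. 2 READ IN b12 TYPING.  For `U : ZdEdge d → 𝔸ˣ` with values in an `AvgClosed` gauge group `G`
  (`B7Prop2Explicit.AvgClosed`; the unitary group of any non-trivial C⋆-algebra qualifies — §4), `2 ≤ L`, and print's (52)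
  `pdev (curry U) < α₀·(Lᵏ)⁻²` with «`α₀ ≤ c₂ = min{1∕(3C₀), ½c₂′}`» as `C₀(d)α₀ ≤ 1∕3`, `2α₀ ≤ c₂′(d,L)`: for EVERY `j ≤ k`
  — `mem_level` (`Ubar j` is `G`-valued), **`norm_level_le_one`**, **`norm_level_inv_le_one`** (the binders `hV`, `hV′`),
  **`pdev_level_lt`** (`pdev (avgIter j) < 2α₀(Lʲ∕Lᵏ)²`, the summed form of (53)), `pdev_level_lt_two_alpha` (`< 2α₀`, (54)'s
  last inequality at every level), **`plaquette_level_le`** (b12 form: `‖plaquetteHolonomyZd (Ubar j) x i i′ − 1‖ ≤ pdev (avgIter j)`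
  — the binder shape of the owner's `ShellMeasureAverageAnalyticRegular`), **`loop_level_le`** (`‖W_x(Ubar j) − 1‖ ≤
  16(d+1)(d+4)L²·pdev (avgIter j)` for every coarse bond `c` and `x ∈ B(c₋)` — p. 25's `O(1)L²α₀` through
  `B7Prop2Explicit.norm_Wcx_sub_one_le`, whose threshold `512(d+1)(d+4)L²·(2α₀) ≤ 1` IS print's «`2α₀ ≤ c₂′`»),
  **`loop_level_le_const`** (`≤ 1∕32`: the binder `hW` of S49 f2 ∕ S57 f1 with `ε = 1∕32 ≤ 1∕8`).
  **`avgIter_regular`** — the three binders at level `j ≤ k` in ONE statement (general `AvgClosed` gauge group).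
* §3 CONSEQUENCE FOR THE W-a∕W-d CHAIN: **`analyticOnNhd_Qtilde_level`**, **`Qtilde_level_zero`**, **`norm_Qtilde_level_le`**
  — the owner's S49 f2 triple (`analyticOnNhd_Qtilde_gammaT`, `Qtilde_zero`, `norm_Qtilde_gammaT_le`, radius `1∕(2816(d+1)L)`)
  at EVERY level-`j` averaged background `Ubar j`, `j ≤ k`, with NO regime binder left: hypotheses = print's (52) on the
  INITIAL configuration + its `G`-valuedness.  ROUTE: through the LOOP binder of S49 f2 (`ε = 1∕32`, §2), NOT through f5
  `ShellMeasureAverageAnalyticRegular` (plaquette binder + `24dL^{d+1}ε₀ < 1`): f5's threshold is the Neumann budget of the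
  `h`-operator of p. 267 and is NOT implied by print's «`α₀ ≤ c₂`» for large `L` (e.g. `d = 4`, `L = 16`:
  `24dL^{d−1}∕(512(d+1)(d+4)) = 19.2 > 1`), whereas b07's p. 25 estimate needs exactly «`2α₀ ≤ c₂′`» — so NO smallness
  beyond Prop. 2's own is introduced here.
* §4 THE PRINTED GAUGE GROUP: `regular_levels_unitary` — §2's three binders for `U(N)`-type groups (the unitary group of a
  non-trivial C⋆-algebra, `B7Prop2Explicit.avgClosed_unitaryUnits`; `M_N(ℂ)` with the operator norm and `G = U(N)` included).

WHAT THIS DOES NOT DO.  The `k`-UNIFORM radius of Prop. 4∕6 (rows S55∕S56: needs the double-bar average's sharp linear part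
(124)–(126); the crude one-step bound `2816(d+1)L` of S49 f2 is unchanged here); the torus and centred cubes (D-b12g20.1
inherited: corner cubes on `ℤᵈ`); a proper Lie subgroup `G ⊂ U(N)` such as `SU(N)` (b07 D-b07g14.1 (b): `AvgClosed` groups
only); anything about Bałaban's minimisers `U_k` — for THOSE backgrounds the regularity stays B11 (19)–(21) ∕ B14 (2.16)–(2.17)
TYPE (WALL W-a; owner journal l.13900 ∕ l.14010); NE7c NOT proved; 0∕9 spine.
-/

noncomputable section

open NormedSpace Metric Set Finset

namespace Summit.QuantumFields.BalabanUV.T4Continuum.ShellMeasureAverageIterateRegular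

open Literature.MathematicalPhysics.QuantumFieldTheory.Balaban1983to89
open Literature.MathematicalPhysics.QuantumLattice (ZdEdge blockMap blockBase blockSites mem_blockSites_iff
  plaquetteHolonomyZd)
open B7BlockGeometry (qppBonds)
open B7Prop1Explicit (hol seg plaqWord boxVec Wcx Xavg bavg expUnit val_expUnit U1 mem_U1)
open B7Prop2Explicit (rescale rescale_apply avgIter avgIter_zero avgIter_succ pdev le_pdev pdev_nonneg C0 c2' C0_pos
  c2'_pos AvgClosed avgIter_mem ineq53_explicit norm_Wcx_sub_one_le unitaryUnits avgClosed_unitaryUnits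
  unitaryUnits_le_U1)
open B12HOperator267 (gammaT)
open B12AverageCorridor267 (expU val_expU avgM Ustr loopW offAxis mem_blockSites_of_mem_offAxis Qtilde)
open B12PlaquetteLoop267 (exists_boxVec hol_seg_eq_lineR loopW_gammaT_eq_Wcx hol_curry_plaqWord)
open MatrixLog (mlog)
open ShellMeasureAverageAnalyticB7 (analyticOnNhd_Qtilde_gammaT norm_Qtilde_gammaT_le Qtilde_zero)

variable {d : ℕ}

/-! ## §1 The dictionary for the AVERAGE: [B7] (15) in the b12 typing IS (42) in the b07 typing -/

section Dictionary

variable {𝔸 : Type*} [NormedRing 𝔸] [NormedAlgebra ℂ 𝔸] [CompleteSpace 𝔸] {L : ℕ}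

omit [NormedAlgebra ℂ 𝔸] [CompleteSpace 𝔸] in
/-- The b07 offset `r ∈ {0,…,L−1}ᵈ` lands in the b12 block `B(y)`. [folklore] -/
theorem blockBase_add_boxVec_mem (L : ℕ) (y : Fin d → ℤ) (r : Fin d → Fin L) :
    blockBase L y + boxVec L r ∈ blockSites L y := by
  unfold blockSites
  refine Finset.mem_image.2 ⟨fun i => (r i : ℕ), ?_, rfl⟩
  exact Fintype.mem_piFinset.2 fun i => Finset.mem_range.2 (r i).isLt

omit [NormedAlgebra ℂ 𝔸] [CompleteSpace 𝔸] in
/-- A sum over the corner block `B(y) = L y + {0,…,L−1}ᵈ` of the b12 lineage (`blockSites`, a `Finset` of sites) is a sum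
over b07's offsets `r : Fin d → Fin L` (`boxVec`) — the two lineages' indexings of [B7] (2) «`B^j(y)`». [folklore] -/
theorem sum_blockSites_eq_sum_boxVec {β : Type*} [AddCommMonoid β] (L : ℕ) (y : Fin d → ℤ) (F : (Fin d → ℤ) → β) :
    ∑ x ∈ blockSites L y, F x = ∑ r : Fin d → Fin L, F (blockBase L y + boxVec L r) := by
  symm
  refine Finset.sum_bij (fun r _ => blockBase L y + boxVec L r) (fun r _ => blockBase_add_boxVec_mem L y r)
    (fun r₁ _ r₂ _ h => ?_) (fun x hx => ?_) (fun _ _ => rfl)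
  · have h' : boxVec L r₁ = boxVec L r₂ := add_left_cancel h
    funext i
    have hi := congrFun h' i
    simp only [boxVec, Nat.cast_inj] at hi
    exact Fin.ext hi
  · obtain ⟨r, hr⟩ := exists_boxVec hx
    exact ⟨r, mem_univ _, by rw [← hr, add_sub_cancel]⟩

/-- The two lineages' «`exp` as a unit» agree. [folklore] -/
theorem expU_eq_expUnit (a : 𝔸) : expU a = expUnit a := Units.ext rfl

omit [NormedAlgebra ℂ 𝔸] [CompleteSpace 𝔸] in
/-- The straight transporter `U(c)` along the coarse bond: b12's `Ustr` (ordered product `lineR`) IS b07's word holonomy of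
the segment `[L c₋, L c₋ + L e_μ]` (`B12PlaquetteLoop267.hol_seg_eq_lineR`). [cite: Balaban1985Averaging, (15) p.19] -/
theorem Ustr_eq_hol_seg (U : ZdEdge d → 𝔸ˣ) (c : ZdEdge d) :
    Ustr L U c = hol (Function.curry U) (blockBase L c.1) (seg c.2 (L : ℤ)) := by
  rw [Ustr, hol_seg_eq_lineR]

/-- **THE PRINTED AVERAGE (15) IN THE b12 TYPING IS b07's (42).**  For every configuration `U : ZdEdge d → 𝔸ˣ` and every
coarse bond `c = (c₋, μ)`: `avgM L (gammaT L ·) U c = bavg L (curry U) (L c₋) μ` — the exponent's sum over `B(c₋)` is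
re-indexed by `sum_blockSites_eq_sum_boxVec`, each loop is b07's `Wcx` by `loopW_gammaT_eq_Wcx`, the scalar `((L:ℂ)ᵈ)⁻¹`
is the real scalar `((L:ℝ)ᵈ)⁻¹` (`Complex.coe_smul`), and `U(c)` is `Ustr_eq_hol_seg`. [cite: Balaban1985Averaging, (15) p.19, (42) p.23] -/
theorem avgM_gammaT_eq_bavg (hL : 0 < L) (U : ZdEdge d → 𝔸ˣ) (c : ZdEdge d) :
    avgM L (fun U : ZdEdge d → 𝔸ˣ => gammaT L U) U c = bavg L (Function.curry U) (blockBase L c.1) c.2 := by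
  rw [avgM, expU_eq_expUnit, Ustr_eq_hol_seg]
  show expUnit _ * _ = expUnit (Xavg L (Function.curry U) (blockBase L c.1) c.2) * _
  congr 2
  rw [Xavg, sum_blockSites_eq_sum_boxVec]
  refine sum_congr rfl fun r _ => ?_
  rw [loopW_gammaT_eq_Wcx hL U c (blockBase_add_boxVec_mem L c.1 r), add_sub_cancel_left, ← Complex.coe_smul]
  push_cast
  rfl

omit [NormedAlgebra ℂ 𝔸] [CompleteSpace 𝔸] in
/-- b12's block base point `L·y` is b07's rescaling point `(L : ℤ) • y`. [folklore] -/
theorem blockBase_eq_zsmul (L : ℕ) (y : Fin d → ℤ) : blockBase L y = (L : ℤ) • y := by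
  funext i
  simp [blockBase, Pi.smul_apply]

/-- **THE ONE-STEP AVERAGED CONFIGURATION ON THE COARSE LATTICE `ℤᵈ` IS b07's RESCALED AVERAGE** ((43) read on the unit
lattice, `B7Prop2Explicit.rescale`): `avgM L gammaT U (y, μ) = rescale L (bavg L (curry U)) y μ`. [cite: Balaban1985Averaging, (43) p.24] -/
theorem avgM_gammaT_eq_rescale_bavg (hL : 0 < L) (U : ZdEdge d → 𝔸ˣ) (c : ZdEdge d) :
    avgM L (fun U : ZdEdge d → 𝔸ˣ => gammaT L U) U c = rescale L (bavg L (Function.curry U)) c.1 c.2 := by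
  rw [avgM_gammaT_eq_bavg hL, rescale_apply, blockBase_eq_zsmul]

/-- … i.e. it is the first level `Ū¹` of b07's `k`-fold average `avgIter` (43), uncurried. [cite: Balaban1985Averaging, (43) p.24] -/
theorem avgM_gammaT_eq_avgIter_one (hL : 0 < L) (U : ZdEdge d → 𝔸ˣ) :
    (fun c => avgM L (fun U : ZdEdge d → 𝔸ˣ => gammaT L U) U c) = Function.uncurry (avgIter L (Function.curry U) 1) := by
  funext c
  rw [avgM_gammaT_eq_rescale_bavg hL, avgIter_succ, avgIter_zero]
  rfl

/-- Level `0` of the averaged backgrounds is the configuration itself. [folklore] -/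
theorem uncurry_avgIter_zero (U : ZdEdge d → 𝔸ˣ) : Function.uncurry (avgIter L (Function.curry U) 0) = U := by
  rw [avgIter_zero, Function.uncurry_curry]

/-- **THE b12 RECURSION OF THE LEVEL-`j` AVERAGED BACKGROUNDS** `Ubar j := uncurry (avgIter L (curry U) j)` ([B7] (43)
«`Ū^{k+1}_c = \overline{(Ū^k)}_c`»): `Ubar (j+1) c = avgM L gammaT (Ubar j) c`. [cite: Balaban1985Averaging, (43) p.24] -/
theorem uncurry_avgIter_succ (hL : 0 < L) (U : ZdEdge d → 𝔸ˣ) (j : ℕ) (c : ZdEdge d) :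
    Function.uncurry (avgIter L (Function.curry U) (j + 1)) c
      = avgM L (fun U : ZdEdge d → 𝔸ˣ => gammaT L U) (Function.uncurry (avgIter L (Function.curry U) j)) c := by
  rw [avgM_gammaT_eq_rescale_bavg hL, Function.curry_uncurry, avgIter_succ]
  rfl

/-- Hence ANY b12-side `k`-fold iterate of the (15)-average defined by that recursion (e.g. row S57 f2's) is `Ubar`.
[folklore] -/
theorem iterate_eq_uncurry_avgIter (hL : 0 < L) (I : ℕ → (ZdEdge d → 𝔸ˣ) → ZdEdge d → 𝔸ˣ)
    (h0 : ∀ U, I 0 U = U) (hs : ∀ j U c, I (j + 1) U c = avgM L (fun U : ZdEdge d → 𝔸ˣ => gammaT L U) (I j U) c)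
    (U : ZdEdge d → 𝔸ˣ) (j : ℕ) : I j U = Function.uncurry (avgIter L (Function.curry U) j) := by
  induction j with
  | zero => rw [h0, uncurry_avgIter_zero]
  | succ j ih =>
    funext c
    rw [hs, ih, uncurry_avgIter_succ hL]

omit [NormedAlgebra ℂ 𝔸] [CompleteSpace 𝔸] in
/-- The b12 ∕ `QuantumLattice` plaquette holonomy of an uncurried b07 configuration is b07's plaquette word holonomy
(`B12PlaquetteLoop267.hol_curry_plaqWord`). [folklore] -/
theorem plaquetteHolonomyZd_uncurry (W : (Fin d → ℤ) → Fin d → 𝔸ˣ) (x : Fin d → ℤ) (i j : Fin d) :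
    plaquetteHolonomyZd (Function.uncurry W) x i j = hol W x (plaqWord i j) := by
  rw [← hol_curry_plaqWord, Function.curry_uncurry]

end Dictionary

/-! ## §2 [B7] Proposition 2 read in the b12 typing: the averaged backgrounds are regular at every level -/

section Regular

variable {𝔸 : Type*} [NormedRing 𝔸] [NormOneClass 𝔸] [NormedAlgebra ℂ 𝔸] [CompleteSpace 𝔸] {L : ℕ}

variable (hL : 2 ≤ L) {G : Subgroup 𝔸ˣ} (hG : AvgClosed d L G) (k : ℕ) (U : ZdEdge d → 𝔸ˣ) (hU : ∀ b, U b ∈ G)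
  {α₀ : ℝ} (hα : 0 < α₀) (hα3 : C0 d * α₀ ≤ 1 / 3) (hα2 : 2 * α₀ ≤ c2' d L)
  (h52 : pdev (Function.curry U) < α₀ * (((L : ℝ) ^ k)⁻¹) ^ 2)
include hL hG hU hα hα3 hα2 h52

/-- Every averaged background `Ū₀ʲ`, `j ≤ k`, is `G`-valued (`B7Prop2Explicit.avgIter_mem`: the tacit clause of p. 26 «we can
apply Proposition 1 to the configuration `Ūʲ`»). [cite: Balaban1985Averaging, (52)–(53) p.26] -/
theorem mem_level {j : ℕ} (hj : j ≤ k) (b : ZdEdge d) : Function.uncurry (avgIter L (Function.curry U) j) b ∈ G :=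
  avgIter_mem L hL hG k (Function.curry U) (fun x κ => hU (x, κ)) hα hα3 hα2 h52 j hj b.1 b.2

/-- **BINDER `hV` AT LEVEL `j ≤ k`:** `‖Ū₀ʲ(b)‖ ≤ 1`. [cite: Balaban1985Averaging, (19) p.21, (52)–(54) p.26] -/
theorem norm_level_le_one {j : ℕ} (hj : j ≤ k) (b : ZdEdge d) :
    ‖((Function.uncurry (avgIter L (Function.curry U) j) b : 𝔸ˣ) : 𝔸)‖ ≤ 1 :=
  (hG.le_U1 (mem_level hL hG k U hU hα hα3 hα2 h52 hj b)).1

/-- **BINDER `hV′` AT LEVEL `j ≤ k`:** `‖Ū₀ʲ(b)⁻¹‖ ≤ 1`. [cite: Balaban1985Averaging, (19) p.21, (52)–(54) p.26] -/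
theorem norm_level_inv_le_one {j : ℕ} (hj : j ≤ k) (b : ZdEdge d) :
    ‖(((Function.uncurry (avgIter L (Function.curry U) j) b)⁻¹ : 𝔸ˣ) : 𝔸)‖ ≤ 1 :=
  (hG.le_U1 (mem_level hL hG k U hU hα hα3 hα2 h52 hj b)).2

/-- **(53) SUMMED: the level-`j` plaquette deviation is `< 2α₀(Lʲη)²`, `η = L^{−k}`** — `B7Prop2Explicit.ineq53_explicit`
with its geometric bracket `≤ 2` (`B7.geom_bracket_le_two`, ratio `(1 + C₀α₀)²∕L² < ½` by `B7.prop2_ratio_lt_half`) and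
`C₀·α₀(Lʲη)² ≤ C₀α₀ ≤ ⅓`. [cite: Balaban1985Averaging, (53) p.26] -/
theorem pdev_level_lt {j : ℕ} (hj : j ≤ k) :
    pdev (avgIter L (Function.curry U) j) < 2 * α₀ * ((L : ℝ) ^ j * ((L : ℝ) ^ k)⁻¹) ^ 2 := by
  have hLr : (2 : ℝ) ≤ L := by exact_mod_cast hL
  have h53 := ineq53_explicit L hL hG k (Function.curry U) (fun x κ => hU (x, κ)) hα hα3 hα2 h52 j hj
  set t : ℝ := (L : ℝ) ^ j * ((L : ℝ) ^ k)⁻¹ with ht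
  have ht0 : 0 ≤ t := by positivity
  have ht1 : t ≤ 1 := by
    rw [ht, ← div_eq_mul_inv, div_le_one (by positivity)]
    exact pow_le_pow_right₀ (by linarith) hj
  have ht2 : t ^ 2 ≤ 1 := pow_le_one₀ ht0 ht1
  have hC := (C0_pos d).le
  have hC0 : 0 ≤ C0 d * α₀ := by positivity
  have hρ : (1 + C0 d * α₀) ^ 2 / (L : ℝ) ^ 2 ≤ 1 / 2 := (B7.prop2_ratio_lt_half (C0 d) α₀ L hLr hC0 hα3).le
  have hgeom := B7.geom_bracket_le_two _ (by positivity) hρ j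
  have ha : 0 ≤ α₀ * t ^ 2 := by positivity
  have hat : α₀ * t ^ 2 ≤ α₀ := mul_le_of_le_one_right hα.le ht2
  have hCa : C0 d * (α₀ * t ^ 2) ≤ 1 / 3 := (mul_le_mul_of_nonneg_left hat hC).trans hα3
  have hsq : 0 ≤ C0 d * (α₀ * t ^ 2) ^ 2 := by positivity
  calc pdev (avgIter L (Function.curry U) j)
      < α₀ * t ^ 2 + C0 d * (α₀ * t ^ 2) ^ 2 * ∑ i ∈ Finset.range j, ((1 + C0 d * α₀) ^ 2 / (L : ℝ) ^ 2) ^ i := h53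
    _ ≤ α₀ * t ^ 2 + C0 d * (α₀ * t ^ 2) ^ 2 * 2 := by
        have := mul_le_mul_of_nonneg_left hgeom hsq
        linarith
    _ = α₀ * t ^ 2 * (1 + 2 * (C0 d * (α₀ * t ^ 2))) := by ring
    _ ≤ α₀ * t ^ 2 * (1 + 2 * (1 / 3)) := by
        have : 1 + 2 * (C0 d * (α₀ * t ^ 2)) ≤ 1 + 2 * (1 / 3 : ℝ) := by linarith
        exact mul_le_mul_of_nonneg_left this ha
    _ ≤ 2 * α₀ * t ^ 2 := by nlinarith

/-- **… hence `< 2α₀` at every level** ((54)'s last inequality, uniformly in `j ≤ k`). [cite: Balaban1985Averaging, (54) p.26] -/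
theorem pdev_level_lt_two_alpha {j : ℕ} (hj : j ≤ k) : pdev (avgIter L (Function.curry U) j) < 2 * α₀ := by
  have hLr : (2 : ℝ) ≤ L := by exact_mod_cast hL
  have h := pdev_level_lt hL hG k U hU hα hα3 hα2 h52 hj
  have ht1 : (L : ℝ) ^ j * ((L : ℝ) ^ k)⁻¹ ≤ 1 := by
    rw [← div_eq_mul_inv, div_le_one (by positivity)]
    exact pow_le_pow_right₀ (by linarith) hj
  have ht0 : 0 ≤ (L : ℝ) ^ j * ((L : ℝ) ^ k)⁻¹ := by positivity
  have ht2 : ((L : ℝ) ^ j * ((L : ℝ) ^ k)⁻¹) ^ 2 ≤ 1 := pow_le_one₀ ht0 ht1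
  exact h.trans_le (mul_le_of_le_one_right (by positivity) ht2)

/-- **PLAQUETTE REGULARITY OF `Ū₀ʲ` IN THE b12 FORM** (the binder shape «`‖V(∂p) − 1‖ ≤ ε₀` for all plaquettes» of the
owner's `ShellMeasureAverageAnalyticRegular`, [Balaban1987RG1] p. 254): `‖plaquetteHolonomyZd (Ubar j) x i i′ − 1‖ ≤ pdev (avgIter j)`
(`< 2α₀(Lʲη)²` by `pdev_level_lt`). [cite: Balaban1985Averaging, (53)–(54) p.26] -/
theorem plaquette_level_le {j : ℕ} (hj : j ≤ k) (x : Fin d → ℤ) (i i' : Fin d) :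
    ‖((plaquetteHolonomyZd (Function.uncurry (avgIter L (Function.curry U) j)) x i i' : 𝔸ˣ) : 𝔸) - 1‖
      ≤ pdev (avgIter L (Function.curry U) j) := by
  rw [plaquetteHolonomyZd_uncurry]
  exact le_pdev (fun y κ => hG.le_U1 (mem_level hL hG k U hU hα hα3 hα2 h52 hj (y, κ))) x i i'

/-- **LOOP REGULARITY OF `Ū₀ʲ`** (p. 25 «`|V₀(Γ_{c,x}) − 1| < … = O(1)L²α₀`» at level `j`, gauge-free, through
`B7Prop2Explicit.norm_Wcx_sub_one_le` and the loop dictionary `B12PlaquetteLoop267.loopW_gammaT_eq_Wcx`): for every coarse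
bond `c` and every `x ∈ B(c₋)`, `‖W_x(Ū₀ʲ) − 1‖ ≤ 16(d+1)(d+4)L²·pdev (avgIter j)`; the smallness `512(d+1)(d+4)L²·pdev ≤ 1`
needed is print's «`2α₀ ≤ c₂′`». [cite: Balaban1985Averaging, p.25, (52)–(54) p.26] -/
theorem loop_level_le {j : ℕ} (hj : j ≤ k) (c : ZdEdge d) {x : Fin d → ℤ} (hx : x ∈ blockSites L c.1) :
    ‖((loopW L (fun U : ZdEdge d → 𝔸ˣ => gammaT L U) (Function.uncurry (avgIter L (Function.curry U) j)) c x : 𝔸ˣ) : 𝔸)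
        - 1‖ ≤ 2 * (8 * (d + 1) * (d + 4) * (L : ℝ) ^ 2 * pdev (avgIter L (Function.curry U) j)) := by
  have hL0 : 0 < L := lt_of_lt_of_le (by norm_num) hL
  have hL1 : 1 ≤ L := hL0
  set W := avgIter L (Function.curry U) j with hW
  have hWU : ∀ y κ, W y κ ∈ U1 𝔸 := fun y κ => hG.le_U1 (mem_level hL hG k U hU hα hα3 hα2 h52 hj (y, κ))
  have hP := pdev_level_lt_two_alpha hL hG k U hU hα hα3 hα2 h52 hj
  have hpos : (0 : ℝ) < 512 * ((d : ℝ) + 1) * (d + 4) * (L : ℝ) ^ 2 := by positivity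
  have hsmall : 512 * (d + 1) * (d + 4) * (L : ℝ) ^ 2 * pdev W ≤ 1 := by
    have h1 : pdev W ≤ 1 / (512 * ((d : ℝ) + 1) * (d + 4) * (L : ℝ) ^ 2) := (hP.le.trans hα2).trans (le_of_eq rfl)
    rw [le_div_iff₀ hpos] at h1
    linarith
  obtain ⟨r, hr⟩ := exists_boxVec hx
  rw [loopW_gammaT_eq_Wcx hL0 _ c hx, Function.curry_uncurry, hr]
  exact norm_Wcx_sub_one_le L hL1 W hWU (pdev_nonneg W) hsmall (fun y κ κ' _ => le_pdev hWU y κ κ') _ c.2 r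

/-- **BINDER `hW` AT LEVEL `j ≤ k` WITH `ε = 1∕32`:** `‖W_x(Ū₀ʲ) − 1‖ ≤ 1∕32` for every coarse bond `c` and every off-axis
`x ∈ B(c₋)` (`16(d+1)(d+4)L²·2α₀ ≤ 16(d+1)(d+4)L²·c₂′ = 1∕32`). [cite: Balaban1985Averaging, p.25, (54) p.26] -/
theorem loop_level_le_const {j : ℕ} (hj : j ≤ k) (c : ZdEdge d) {x : Fin d → ℤ} (hx : x ∈ offAxis L c) :
    ‖((loopW L (fun U : ZdEdge d → 𝔸ˣ => gammaT L U) (Function.uncurry (avgIter L (Function.curry U) j)) c x : 𝔸ˣ) : 𝔸)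
        - 1‖ ≤ 1 / 32 := by
  have h := loop_level_le hL hG k U hU hα hα3 hα2 h52 hj c (mem_blockSites_of_mem_offAxis hx)
  have hP := pdev_level_lt_two_alpha hL hG k U hU hα hα3 hα2 h52 hj
  have hpos : (0 : ℝ) < 512 * ((d : ℝ) + 1) * (d + 4) * (L : ℝ) ^ 2 := by positivity
  have hc : 2 * α₀ ≤ 1 / (512 * ((d : ℝ) + 1) * (d + 4) * (L : ℝ) ^ 2) := hα2.trans (le_of_eq rfl)
  rw [le_div_iff₀ hpos] at hc
  have hK : 0 ≤ 8 * ((d : ℝ) + 1) * (d + 4) * (L : ℝ) ^ 2 := by positivity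
  refine h.trans ?_
  nlinarith [mul_le_mul_of_nonneg_left hP.le hK]

/-- **[B7] PROPOSITION 2 IN THE b12 TYPING — THE THREE REGIME BINDERS AT LEVEL `j ≤ k` AT ONCE:** `Ū₀ʲ` is
`G`-valued (hence unit-bounded), every plaquette deviates from `1` by `< 2α₀(Lʲη)²`, every off-axis block loop by `≤ 1∕32`
— for any `AvgClosed` gauge group `G`, from print's (52) on the initial configuration alone. [cite: Balaban1985Averaging, Prop. 2 (52)–(54) p.26] -/
theorem avgIter_regular {j : ℕ} (hj : j ≤ k) :
    (∀ b, Function.uncurry (avgIter L (Function.curry U) j) b ∈ G) ∧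
      (∀ (x : Fin d → ℤ) (i i' : Fin d),
        ‖((plaquetteHolonomyZd (Function.uncurry (avgIter L (Function.curry U) j)) x i i' : 𝔸ˣ) : 𝔸) - 1‖
          < 2 * α₀ * ((L : ℝ) ^ j * ((L : ℝ) ^ k)⁻¹) ^ 2) ∧
      ∀ (c : ZdEdge d), ∀ x ∈ offAxis L c,
        ‖((loopW L (fun U : ZdEdge d → 𝔸ˣ => gammaT L U) (Function.uncurry (avgIter L (Function.curry U) j)) c x : 𝔸ˣ)
            : 𝔸) - 1‖ ≤ 1 / 32 :=
  ⟨fun b => mem_level hL hG k U hU hα hα3 hα2 h52 hj b,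
    fun x i i' => (plaquette_level_le hL hG k U hU hα hα3 hα2 h52 hj x i i').trans_lt
      (pdev_level_lt hL hG k U hU hα hα3 hα2 h52 hj),
    fun c _ hx => loop_level_le_const hL hG k U hU hα hα3 hα2 h52 hj c hx⟩

/-! ## §3 Consequence: the chart average at every averaged background, with no regime binder -/

/-- **THE PRINTED BLOCK AVERAGE IN THE CHART IS ANALYTIC AT EVERY LEVEL-`j` AVERAGED BACKGROUND `Ū₀ʲ`, `j ≤ k`,** on
`ball 0 (1∕(2816(d+1)L))` — the owner's `ShellMeasureAverageAnalyticB7.analyticOnNhd_Qtilde_gammaT` with `hV`, `hV′`, `hW`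
supplied by §2 (`ε = 1∕32`); hypotheses: print's (52) on `U` and its `G`-valuedness only. [folklore] -/
theorem analyticOnNhd_Qtilde_level {j : ℕ} (hj : j ≤ k) (c : ZdEdge d) :
    AnalyticOnNhd ℂ (fun B : ↥(qppBonds L c) → 𝔸 =>
        Qtilde L (fun U : ZdEdge d → 𝔸ˣ => gammaT L U) (Function.uncurry (avgIter L (Function.curry U) j))
          (Function.extend Subtype.val B (0 : ZdEdge d → 𝔸)) c)
      (ball 0 (1 / (2816 * ((d : ℝ) + 1) * L))) :=
  analyticOnNhd_Qtilde_gammaT (lt_of_lt_of_le (by norm_num) hL) (norm_level_le_one hL hG k U hU hα hα3 hα2 h52 hj)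
    (norm_level_inv_le_one hL hG k U hU hα hα3 hα2 h52 hj) (by norm_num : (0 : ℝ) ≤ 1 / 32)
    (by norm_num : (1 : ℝ) / 32 ≤ 1 / 8) (fun x hx => loop_level_le_const hL hG k U hU hα hα3 hα2 h52 hj c hx)

omit hL hG hU hα hα3 hα2 h52 in
omit [NormOneClass 𝔸] in
/-- … VANISHES AT `0` (no hypothesis; `ShellMeasureAverageAnalyticB7.Qtilde_zero` with `extend 0 = 0`). [folklore] -/
theorem Qtilde_level_zero (j : ℕ) (c : ZdEdge d) :
    Qtilde L (fun U : ZdEdge d → 𝔸ˣ => gammaT L U) (Function.uncurry (avgIter L (Function.curry U) j))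
        (Function.extend Subtype.val (0 : ↥(qppBonds L c) → 𝔸) (0 : ZdEdge d → 𝔸)) c = 0 := by
  rw [ShellMeasureAverageAnalyticB7.extend_zero]
  exact Qtilde_zero L _ _ c

/-- **… AND IS BOUNDED BY `2816(d+1)L·‖B‖`** there, at every level `j ≤ k` (`norm_Qtilde_gammaT_le` with §2's binders).
[folklore] -/
theorem norm_Qtilde_level_le {j : ℕ} (hj : j ≤ k) (c : ZdEdge d) {B : ↥(qppBonds L c) → 𝔸}
    (hB : ‖B‖ < 1 / (2816 * ((d : ℝ) + 1) * L)) :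
    ‖Qtilde L (fun U : ZdEdge d → 𝔸ˣ => gammaT L U) (Function.uncurry (avgIter L (Function.curry U) j))
        (Function.extend Subtype.val B (0 : ZdEdge d → 𝔸)) c‖ ≤ 2816 * ((d : ℝ) + 1) * L * ‖B‖ :=
  norm_Qtilde_gammaT_le (lt_of_lt_of_le (by norm_num) hL) (norm_level_le_one hL hG k U hU hα hα3 hα2 h52 hj)
    (norm_level_inv_le_one hL hG k U hU hα hα3 hα2 h52 hj) (by norm_num : (0 : ℝ) ≤ 1 / 32)
    (by norm_num : (1 : ℝ) / 32 ≤ 1 / 8) (fun x hx => loop_level_le_const hL hG k U hU hα hα3 hα2 h52 hj c hx) hB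

end Regular

/-! ## §4 The printed gauge group `U(N)`: the unitary group of a C⋆-algebra -/

section Unitary

variable {𝔸 : Type*} [CStarAlgebra 𝔸] [Nontrivial 𝔸] {L : ℕ}

/-- **THE THREE REGIME BINDERS AT EVERY LEVEL FOR `U(N)`-VALUED CONFIGURATIONS** (print's gauge group, p. 18 ∕ p. 23; the
unitary group of a non-trivial C⋆-algebra, `M_N(ℂ)` with the operator norm (19) included — `B7Prop2Explicit.avgClosed_unitaryUnits`):
under (52) with `C₀α₀ ≤ ⅓`, `2α₀ ≤ c₂′`, for every `j ≤ k`: `Ū₀ʲ` is unitary-valued (so `‖Ū₀ʲ(b)‖, ‖Ū₀ʲ(b)⁻¹‖ ≤ 1`), its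
plaquettes deviate from `1` by `< 2α₀(Lʲη)²`, and its block loops by `≤ 1∕32`. [cite: Balaban1985Averaging, Prop. 2 (52)–(54) p.26] -/
theorem regular_levels_unitary (hL : 2 ≤ L) (k : ℕ) (U : ZdEdge d → 𝔸ˣ) (hU : ∀ b, U b ∈ unitaryUnits 𝔸) {α₀ : ℝ}
    (hα : 0 < α₀) (hα3 : C0 d * α₀ ≤ 1 / 3) (hα2 : 2 * α₀ ≤ c2' d L)
    (h52 : pdev (Function.curry U) < α₀ * (((L : ℝ) ^ k)⁻¹) ^ 2) {j : ℕ} (hj : j ≤ k) :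
    (∀ b, Function.uncurry (avgIter L (Function.curry U) j) b ∈ unitaryUnits 𝔸) ∧
      (∀ (x : Fin d → ℤ) (i i' : Fin d),
        ‖((plaquetteHolonomyZd (Function.uncurry (avgIter L (Function.curry U) j)) x i i' : 𝔸ˣ) : 𝔸) - 1‖
          < 2 * α₀ * ((L : ℝ) ^ j * ((L : ℝ) ^ k)⁻¹) ^ 2) ∧
      ∀ (c : ZdEdge d), ∀ x ∈ offAxis L c,
        ‖((loopW L (fun U : ZdEdge d → 𝔸ˣ => gammaT L U) (Function.uncurry (avgIter L (Function.curry U) j)) c x : 𝔸ˣ)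
            : 𝔸) - 1‖ ≤ 1 / 32 :=
  avgIter_regular hL (avgClosed_unitaryUnits d L) k U hU hα hα3 hα2 h52 hj

end Unitary

end Summit.QuantumFields.BalabanUV.T4Continuum.ShellMeasureAverageIterateRegular

end
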